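import Mathlib
import Literature.Analysis.FluidPDE.VectorCalculus
import Summits.NavierStokesRegularity.NavierStokesRegularity.Theorems.FilamentSkeletonRssClause13RAdjointWaistSourced

/-!
# Clause 13-R, STUB R at MODEL level: the waist-regular branch is CONTINUOUS ACROSS THE WAIST, with the algebraic waist value
# (census item (R-c′-E), local half, continuity supplement; crux `Clause13RNearStraightL`, stmt-NavierStokesRegularity-23612;
# line `rate_bordered_split`, STUB R `stub_rateRow13RFlat`)

Route `FilamentSkeletonRss`, Variant A1R.  Companion of `…Clause13RAdjointWaistSourced` (p831138: a-priori bound, uniqueness of the waist-regular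
branch) and `…Clause13RAdjointWaistExistence` (hand fsrs-25-g0: existence of the waist-regular branch on each punctured half-ball).  The sourced local
adjoint equation of the MODEL linearised operator,
  `w σ φ′ σ + (½ + w′ σ) φ σ + α e × φ σ + cst·m σ (φ σ × d) = g σ`,
degenerates at the stagnation point `c` of the slip (`w(c) = 0`, `w′(c) > 0`).  THIS FILE proves that the waist-regular (= bounded) branch is
nevertheless CONTINUOUS AT THE WAIST and computes its value there:

* `exists_waistValue` — the algebraic waist equation `(½ + w′(c)) x + α e × x + cst·m(c) (x × d) = g(c)` has a solution `x_c` (the operator is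
  `s·1 + skew` with `s = ½ + w′(c) > 0`, hence injective, hence onto in dimension three), `waistValue_unique` — exactly one;
* `tendsto_waistValue_right` — **every solution on a punctured right half-ball `(c, σ₁]` that is bounded near the waist tends to `x_c` as `σ → c⁺`**
  (apply the landed a-priori bound `wnorm_le_of_waistRegular_right` to `φ − x_c`, whose source `g − g(c) − (w′ − w′(c))x_c − cst(m − m(c))(x_c × d)`
  is small near `c`, and divide by `w ≥ κ₁(σ − c)`); `tendsto_waistValue_left` — the mirror statement on `[σ₁, c)` by the reflection `s ↦ 2c − s`.

Consequently the bounded punctured solutions of `…Clause13RAdjointPunctured(Unique/Apriori)` (p832184/p832285/p832351) extend continuously through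
the waist with the SAME value from both sides — the waist-regular branch is a continuous density on the whole ball, the local solution operator of
census item (R-c′-E) acts on `C(S)`, and its global half is a Fredholm-alternative step (`IsCompactOperator.hasEigenvalue_or_mem_resolventSet` in
Mathlib).  [folklore] (regular-singular point with indicial operator `−((½ + w′(c)) + skew)/w′(c)`: the forced branch is continuous).
Hand `leafhand-ns-filamentskeletonrs-25-g0` (LAND-ONLY); `--supports stmt-NavierStokesRegularity-23612` helper, def-free.  HONEST FRAMING: ODE bookkeeping
for the MODEL adjoint equation attached to a HYPOTHETICAL filament skeleton on the NEGATIVE side of a MODEL blow-up route; STUB R is NOT proved here and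
nothing in this file bears on Navier–Stokes regularity or blow-up.
-/

noncomputable section

open MeasureTheory Filter Topology Set Metric
open scoped RealInnerProductSpace InnerProductSpace
open Literature.Analysis.FluidPDE
open Summit.NavierStokesRegularity.NavierStokesRegularity.Theorems.Clause13RAdjointEnergy (inner_cross_left_swap)
open Summit.NavierStokesRegularity.NavierStokesRegularity.Theorems.Clause13RAdjointWaistSourced
  (wnorm_le_of_waistRegular_right waistRegular_of_bounded_right)

namespace Summit.NavierStokesRegularity.NavierStokesRegularity.Theorems.Clause13RAdjointWaistContinuity
set_option linter.dupNamespace false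

/-! ## §1 The algebraic waist equation `(s + skew) x = y` -/

/-- Pairing `s x + α e × x + cm (x × d)` with `x` kills the skew terms: the result is `s‖x‖²`. [folklore] -/
theorem inner_waistOp_self (s α cm : ℝ) (d e x : EuclideanSpace ℝ (Fin 3)) :
    ⟪s • x + α • cross e x + cm • cross x d, x⟫ = s * ‖x‖ ^ 2 := by
  have he : ⟪cross e x, x⟫ = 0 := by
    simp only [cross, cross_apply, PiLp.inner_apply, RCLike.inner_apply, conj_trivial, Fin.sum_univ_three,
      Matrix.cons_val_zero, Matrix.cons_val_one, Matrix.cons_val_two, Matrix.head_cons, Matrix.tail_cons]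
    ring
  have hd : ⟪cross x d, x⟫ = 0 := by
    have h := inner_cross_left_swap x x d
    linarith
  simp only [inner_add_left, inner_smul_left, conj_trivial, he, hd, real_inner_self_eq_norm_sq, mul_zero, add_zero]

/-- **The waist value exists**: for `s > 0` the equation `s x + α e × x + cm (x × d) = y` has a solution (the operator `s·1 + skew` is injective by
`inner_waistOp_self`, hence surjective on `ℝ³`). [folklore] -/
theorem exists_waistValue {s α cm : ℝ} (hs : 0 < s) (d e y : EuclideanSpace ℝ (Fin 3)) :
    ∃ x : EuclideanSpace ℝ (Fin 3), s • x + α • cross e x + cm • cross x d = y := by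
  set M : EuclideanSpace ℝ (Fin 3) →ₗ[ℝ] EuclideanSpace ℝ (Fin 3) :=
    s • LinearMap.id + α • (crossCLM e).toLinearMap + cm • (crossCLM.flip d).toLinearMap with hM
  have hM_apply : ∀ x, M x = s • x + α • cross e x + cm • cross x d := fun x => by
    simp only [hM, LinearMap.add_apply, LinearMap.smul_apply, LinearMap.id_apply, ContinuousLinearMap.coe_coe, crossCLM_apply,
      ContinuousLinearMap.flip_apply]
  have hinj : Function.Injective M := by
    rw [← LinearMap.ker_eq_bot, LinearMap.ker_eq_bot']
    intro x hx
    have h := inner_waistOp_self s α cm d e x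
    rw [← hM_apply, hx, inner_zero_left] at h
    have hx2 : ‖x‖ ^ 2 = 0 := by
      rcases mul_eq_zero.1 h.symm with h1 | h1
      · exact absurd h1 hs.ne'
      · exact h1
    exact norm_eq_zero.1 ((pow_eq_zero_iff two_ne_zero).1 hx2)
  have hsurj : Function.Surjective M := LinearMap.injective_iff_surjective.1 hinj
  obtain ⟨x, hx⟩ := hsurj y
  exact ⟨x, by rw [← hM_apply]; exact hx⟩

/-- … and is unique. [folklore] -/
theorem waistValue_unique {s α cm : ℝ} (hs : 0 < s) {d e y x₁ x₂ : EuclideanSpace ℝ (Fin 3)}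
    (h₁ : s • x₁ + α • cross e x₁ + cm • cross x₁ d = y) (h₂ : s • x₂ + α • cross e x₂ + cm • cross x₂ d = y) : x₁ = x₂ := by
  have hc1 : cross e (x₁ - x₂) = cross e x₁ - cross e x₂ := by rw [← crossCLM_apply, map_sub]; rfl
  have hc2 : cross (x₁ - x₂) d = cross x₁ d - cross x₂ d := by rw [← crossCLM_apply, map_sub, sub_apply]; rfl
  have hdiff : s • (x₁ - x₂) + α • cross e (x₁ - x₂) + cm • cross (x₁ - x₂) d = 0 := by
    rw [hc1, hc2, smul_sub, smul_sub, smul_sub, ← sub_eq_zero.2 (h₁.trans h₂.symm)]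
    abel
  have h := inner_waistOp_self s α cm d e (x₁ - x₂)
  rw [hdiff, inner_zero_left] at h
  have hx2 : ‖x₁ - x₂‖ ^ 2 = 0 := by
    rcases mul_eq_zero.1 h.symm with h1 | h1
    · exact absurd h1 hs.ne'
    · exact h1
  exact sub_eq_zero.1 (norm_eq_zero.1 ((pow_eq_zero_iff two_ne_zero).1 hx2))

/-! ## §2 The shifted unknown `φ − x_c` solves the equation with a source vanishing at the waist -/

/-- Subtracting a constant vector `x` from a solution of the sourced local adjoint equation: `φ − x` solves the same equation with source
`g − (½ x + w′ x + α e × x + cst·m (x × d))`. [folklore] -/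
theorem shifted_eq {wv wp α cm : ℝ} {φv y gx x : EuclideanSpace ℝ (Fin 3)} {d e : EuclideanSpace ℝ (Fin 3)}
    (h : wv • y + (1 / 2 : ℝ) • φv + wp • φv + α • cross e φv + cm • cross φv d = gx) :
    wv • y + (1 / 2 : ℝ) • (φv - x) + wp • (φv - x) + α • cross e (φv - x) + cm • cross (φv - x) d
      = gx - ((1 / 2 : ℝ) • x + wp • x + α • cross e x + cm • cross x d) := by
  have hc1 : cross e (φv - x) = cross e φv - cross e x := by rw [← crossCLM_apply, map_sub]; rfl
  have hc2 : cross (φv - x) d = cross φv d - cross x d := by rw [← crossCLM_apply, map_sub, sub_apply]; rfl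
  rw [hc1, hc2, ← h]
  simp only [smul_sub]
  abel

/-! ## §3 Continuity at the waist from the right -/

/-- **THE WAIST-REGULAR BRANCH IS CONTINUOUS AT THE WAIST (right half-ball), with the algebraic waist value.**  Slip `w ∈ C¹` with `w(c) = 0`
and `κ₁(s − c) ≤ w(s)` on `(c, σ₁]` (`κ₁ > 0`); `w′, m, g` continuous at `c`; `φ` a solution of the sourced local adjoint equation on the punctured
half-ball `(c, σ₁]`, differentiable there and BOUNDED near the waist (nothing assumed AT `c`); `x_c` a solution of the waist equation
`½ x_c + w′(c) x_c + α e × x_c + cst·m(c) (x_c × d) = g(c)`.  Then `φ(σ) → x_c` as `σ → c⁺`. [folklore] -/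
theorem tendsto_waistValue_right {c σ₁ κ₁ M cst α : ℝ} {m w w' : ℝ → ℝ} {φ φ' g : ℝ → EuclideanSpace ℝ (Fin 3)}
    {d e xc : EuclideanSpace ℝ (Fin 3)} (hσ₁ : c < σ₁) (hκ₁ : 0 < κ₁)
    (hw : ∀ s, HasDerivAt w (w' s) s) (hwc0 : w c = 0) (hw'c : ContinuousAt w' c) (hmc : ContinuousAt m c) (hgc : ContinuousAt g c)
    (hwlow : ∀ s ∈ Ioc c σ₁, κ₁ * (s - c) ≤ w s)
    (hφ : ∀ s ∈ Ioc c σ₁, HasDerivAt φ (φ' s) s) (hbdd : ∀ s ∈ Ioc c σ₁, ‖φ s‖ ≤ M)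
    (heq : ∀ s ∈ Ioc c σ₁,
      w s • φ' s + (1 / 2 : ℝ) • φ s + w' s • φ s + α • cross e (φ s) + (cst * m s) • cross (φ s) d = g s)
    (hxc : (1 / 2 : ℝ) • xc + w' c • xc + α • cross e xc + (cst * m c) • cross xc d = g c) :
    Tendsto φ (𝓝[>] c) (𝓝 xc) := by
  have hwnn : ∀ s ∈ Ioc c σ₁, 0 ≤ w s := fun s hs => (mul_nonneg hκ₁.le (sub_nonneg.2 hs.1.le)).trans (hwlow s hs)
  -- the shifted unknown and its source
  set χ : ℝ → EuclideanSpace ℝ (Fin 3) := fun s => φ s - xc with hχ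
  set gt : ℝ → EuclideanSpace ℝ (Fin 3) := fun s =>
    g s - ((1 / 2 : ℝ) • xc + w' s • xc + α • cross e xc + (cst * m s) • cross xc d) with hgt
  have hχd : ∀ s ∈ Ioc c σ₁, HasDerivAt χ (φ' s) s := fun s hs => by
    have h := (hφ s hs).sub_const xc
    exact h
  have hχeq : ∀ s ∈ Ioc c σ₁,
      w s • φ' s + (1 / 2 : ℝ) • χ s + w' s • χ s + α • cross e (χ s) + (cst * m s) • cross (χ s) d = gt s :=
    fun s hs => shifted_eq (heq s hs)
  -- the shifted source is continuous at `c` and vanishes there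
  have hgtc : ContinuousAt gt c := by
    have h1 : ContinuousAt (fun s => (1 / 2 : ℝ) • xc + w' s • xc + α • cross e xc + (cst * m s) • cross xc d) c :=
      ((continuousAt_const.add (hw'c.smul continuousAt_const)).add continuousAt_const).add
        ((continuousAt_const.mul hmc).smul continuousAt_const)
    exact hgc.sub h1
  have hgt0 : gt c = 0 := by
    simp only [hgt, hxc, sub_self]
  have hgt_tend : Tendsto gt (𝓝 c) (𝓝 0) := by simpa [hgt0] using hgtc.tendsto
  -- waist-regularity of `χ`
  have hwc : Tendsto w (𝓝[>] c) (𝓝 0) := by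
    have h := (hw c).continuousAt.tendsto
    rw [hwc0] at h
    exact h.mono_left nhdsWithin_le_nhds
  have hχbdd : ∀ᶠ s in 𝓝[>] c, ‖χ s‖ ≤ M + ‖xc‖ :=
    eventually_of_mem (Ioc_mem_nhdsGT hσ₁) fun s hs => (norm_sub_le _ _).trans (add_le_add (hbdd s hs) le_rfl)
  have hχreg : Tendsto (fun s => w s * ‖χ s‖) (𝓝[>] c) (𝓝 0) := waistRegular_of_bounded_right hwc hχbdd
  -- ε-δ
  refine Metric.tendsto_nhdsWithin_nhds.2 fun ε hε => ?_
  have hεκ : 0 < ε * κ₁ / 2 := by positivity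
  obtain ⟨ρ, hρ, hρg⟩ := Metric.eventually_nhds_iff.1 ((Metric.tendsto_nhds.1 hgt_tend) (ε * κ₁ / 2) hεκ)
  refine ⟨min ρ (σ₁ - c), lt_min hρ (sub_pos.2 hσ₁), fun s hs hsd => ?_⟩
  have hsc : c < s := hs
  have hs1 : s ∈ Ioc c σ₁ := by
    refine ⟨hsc, ?_⟩
    have : dist s c < σ₁ - c := lt_of_lt_of_le hsd (min_le_right _ _)
    rw [Real.dist_eq, abs_of_pos (sub_pos.2 hsc)] at this
    linarith
  -- a-priori bound for `χ` on the punctured half-ball `(c, s]` with the small source bound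
  have hsub : Ioc c s ⊆ Ioc c σ₁ := fun x hx => ⟨hx.1, hx.2.trans hs1.2⟩
  have hgs : ∀ x ∈ Ioc c s, ‖gt x‖ ≤ ε * κ₁ / 2 := by
    intro x hx
    have hxd : dist x c < ρ := by
      have h1 : dist s c < ρ := lt_of_lt_of_le hsd (min_le_left _ _)
      rw [Real.dist_eq, abs_of_pos (sub_pos.2 hsc)] at h1
      rw [Real.dist_eq, abs_of_pos (sub_pos.2 hx.1)]
      linarith [hx.2]
    have := hρg hxd
    rw [dist_zero_right] at this
    exact this.le
  have hkey := wnorm_le_of_waistRegular_right (σ₁ := s) (φ := χ) (φ' := φ') (G := ε * κ₁ / 2)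
    (fun x _ => hw x) (fun x hx => hχd x (hsub hx)) (fun x hx => hwnn x (hsub hx)) hgs
    (fun x hx => hχeq x (hsub hx)) hχreg ⟨hsc, le_rfl⟩
  -- divide by `w s ≥ κ₁ (s − c) > 0`
  have hws : κ₁ * (s - c) ≤ w s := hwlow s hs1
  have hsc' : 0 < s - c := sub_pos.2 hsc
  have h3 : κ₁ * (s - c) * ‖χ s‖ ≤ κ₁ * (s - c) * (ε / 2) :=
    calc κ₁ * (s - c) * ‖χ s‖ ≤ w s * ‖χ s‖ := mul_le_mul_of_nonneg_right hws (norm_nonneg _)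
      _ ≤ ε * κ₁ / 2 * (s - c) := hkey
      _ = κ₁ * (s - c) * (ε / 2) := by ring
  have hχle : ‖χ s‖ ≤ ε / 2 := le_of_mul_le_mul_left h3 (mul_pos hκ₁ hsc')
  rw [dist_eq_norm]
  linarith

/-! ## §4 Continuity at the waist from the left (reflection `s ↦ 2c − s`) -/

/-- **Mirror statement, left half-ball `[σ₁, c)`**: slip with `κ₁(c − s) ≤ −w(s)` there; a solution bounded near the waist tends to the SAME
algebraic waist value `x_c` as `σ → c⁻`. [folklore] -/
theorem tendsto_waistValue_left {σ₁ c κ₁ M cst α : ℝ} {m w w' : ℝ → ℝ} {φ φ' g : ℝ → EuclideanSpace ℝ (Fin 3)}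
    {d e xc : EuclideanSpace ℝ (Fin 3)} (hσ₁ : σ₁ < c) (hκ₁ : 0 < κ₁)
    (hw : ∀ s, HasDerivAt w (w' s) s) (hwc0 : w c = 0) (hw'c : ContinuousAt w' c) (hmc : ContinuousAt m c) (hgc : ContinuousAt g c)
    (hwlow : ∀ s ∈ Ico σ₁ c, κ₁ * (c - s) ≤ -w s)
    (hφ : ∀ s ∈ Ico σ₁ c, HasDerivAt φ (φ' s) s) (hbdd : ∀ s ∈ Ico σ₁ c, ‖φ s‖ ≤ M)
    (heq : ∀ s ∈ Ico σ₁ c,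
      w s • φ' s + (1 / 2 : ℝ) • φ s + w' s • φ s + α • cross e (φ s) + (cst * m s) • cross (φ s) d = g s)
    (hxc : (1 / 2 : ℝ) • xc + w' c • xc + α • cross e xc + (cst * m c) • cross xc d = g c) :
    Tendsto φ (𝓝[<] c) (𝓝 xc) := by
  -- reflected data
  have hr : ∀ s, HasDerivAt (fun s : ℝ => 2 * c - s) (-1) s := fun s => (hasDerivAt_id' s).const_sub (2 * c)
  have hwr : ∀ s, HasDerivAt (fun s => -w (2 * c - s)) (w' (2 * c - s)) s := fun s => by
    have h := ((hw (2 * c - s)).scomp s (hr s)).neg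
    simp only [smul_eq_mul, neg_mul, one_mul, neg_neg] at h
    exact h
  have hrc : ContinuousAt (fun s : ℝ => 2 * c - s) c := (continuous_const.sub continuous_id).continuousAt
  have h2c : 2 * c - c = c := by ring
  have hmem : ∀ s ∈ Ioc c (2 * c - σ₁), 2 * c - s ∈ Ico σ₁ c := fun s hs => ⟨by linarith [hs.2], by linarith [hs.1]⟩
  have hψ := tendsto_waistValue_right (c := c) (σ₁ := 2 * c - σ₁) (κ₁ := κ₁) (M := M) (cst := cst) (α := α)
    (m := fun s => m (2 * c - s)) (w := fun s => -w (2 * c - s)) (w' := fun s => w' (2 * c - s)) (g := fun s => g (2 * c - s))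
    (φ := fun s => φ (2 * c - s)) (φ' := fun s => -φ' (2 * c - s)) (d := d) (e := e) (xc := xc)
    (by linarith) hκ₁ hwr (by simp only [h2c, hwc0, neg_zero])
    (by have h := hw'c; rw [← h2c] at h; exact ContinuousAt.comp h hrc)
    (by have h := hmc; rw [← h2c] at h; exact ContinuousAt.comp h hrc)
    (by have h := hgc; rw [← h2c] at h; exact ContinuousAt.comp h hrc)
    (fun s hs => by have := hwlow (2 * c - s) (hmem s hs); linarith)
    (fun s hs => by
      have h := (hφ (2 * c - s) (hmem s hs)).scomp s (hr s)
      simp only [neg_smul, one_smul] at h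
      exact h)
    (fun s hs => hbdd (2 * c - s) (hmem s hs))
    (fun s hs => by
      have h := heq (2 * c - s) (hmem s hs)
      rw [smul_neg, ← neg_smul, neg_neg]
      exact h)
    (by simpa only [h2c] using hxc)
  -- pull back along the reflection: `s ↦ 2c − s` maps `𝓝[<] c` to `𝓝[>] c`
  have hmap : Tendsto (fun s : ℝ => 2 * c - s) (𝓝[<] c) (𝓝[>] c) := by
    refine tendsto_nhdsWithin_of_tendsto_nhds_of_eventually_within _ ?_ ?_
    · have h := hrc.tendsto; rw [h2c] at h; exact h.mono_left nhdsWithin_le_nhds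
    · exact eventually_of_mem self_mem_nhdsWithin fun s hs => by
        simp only [mem_Ioi]; simp only [mem_Iio] at hs; linarith
  have h := hψ.comp hmap
  refine h.congr fun s => ?_
  simp only [Function.comp_apply, sub_sub_cancel]

end Summit.NavierStokesRegularity.NavierStokesRegularity.Theorems.Clause13RAdjointWaistContinuity

end
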